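import Literature.NumberTheory.ComplexMultiplication.CMTypeRankForeignQuadraticSlot
import Literature.AlgebraicGeometry.Pohlmann1968.SimpleCMFourfoldWeilType
import HarnessLib

/-!
# A SHARED SIGN CHARACTER on the complex embeddings of two number fields is the sign of a SHARED IMAGINARY QUADRATIC
# SUBFIELD

COR-CM (cell `pub-hodgecm2`, binder seat `b16` gen 46, count-neutral claim PRIME-SLOT, file F2; theorems only, no
definition, no named fact, no `sorry`).  NEW as stated, hence under `Summits/`.  `Aut(ℂ)` acts on `Hom(K, ℂ)` by
composition (the tree's scoped `ringEquivCompAction`).  A **sign character carried by `K`** is a function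
`χ : Aut(ℂ) → ℚ` admitting a non-zero ANTI-INVARIANT EIGENVECTOR `f : Hom(K, ℂ) → ℚ`: `f(s̄) = −f(s)` and
`f ∘ g = χ(g) f` for all `g ∈ Aut(ℂ)`.  The model: `k ⊆ K` imaginary quadratic, `f(s) = ±1` the sign of `s|_k`,
`χ(g) = ±1` according as `g` fixes or conjugates `k ⊂ ℂ` — seat b23's mechanism by which two CM fields SHARING an
imaginary quadratic field make every family of CM types degenerate (`Literature/…/CMTypeRankSharedCharacter`,
`…/SharedImaginaryQuadraticDegenerate`).  This file proves the CONVERSE: every sign character arises this way, and a sign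
character carried by two fields is the sign of an imaginary quadratic subfield of the one that EMBEDS in the other.

* §1 `eq_one_or_eq_neg_one_of_eigen` — `χ = ±1` (`Σ_s f(g s)² = Σ_s f(s)²`); `apply_eq_or_eq_neg_of_eigen` — `f` takes
  only the values `±f(x₀)` (`Aut(ℂ)` is transitive on `Hom(K, ℂ)`); `eq_neg_one_of_eigen` — `χ(conj) = −1`.
* §2 **`exists_quadratic_subfield_of_eigen`** — the level set `S = {f = f(x₀)}` is a BLOCK with the two translates `S`,
  `S̄ = {f = −f(x₀)}`, hence (Shimura §8.2, the tree's `exists_intermediateField_forall_mem_iff_of_block`) the fibre of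
  `Hom(K, ℂ) → Hom(k, ℂ)` over `x₀|_k` for an intermediate field `k`; `|S| = [K:ℚ]/2` gives `[k:ℚ] = 2`, `x̄₀ ∉ S` makes
  `k` TOTALLY COMPLEX, and every `τ ∈ Aut(ℂ)` fixing the embeddings of `k` has `χ(τ) = 1`.
* §3 **`exists_quadratic_subfield_ringHom_of_shared_eigen`** — if the SAME `χ` also has a non-zero anti-invariant
  eigenvector `f'` on `Hom(K', ℂ)` for a second number field `K'`, then that `k` EMBEDS in `K'`: otherwise the
  automorphisms fixing `k` act transitively on `Hom(K', ℂ)` (b16 gen 37, `exists_ringEquiv_smul_eq_of_isEmpty`), so `f'`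
  is constant, and an anti-invariant constant is `0`.  Output in the census vocabulary of the tree:
  `∃ F : IntermediateField ℚ K, finrank ℚ F = 2 ∧ IsTotallyComplex F ∧ Nonempty (F →+* K')`.

Consumer: `CorCM/PrimeDegreeSlotPairsHodge` (with `CorCM/FixingCycleSlotPairs`: for a slot of prime half-degree against a
smaller slot every common constituent is a shared sign character).  HONEST FRAMING: Galois theory of number fields;
`HC_CM` is neither used nor asserted.

## References

* [Shimura1998] G. Shimura, *Abelian Varieties with Complex Multiplication and Modular Functions*, §8.2 (proof of
  Prop. 26), §8.3 Prop. 28, §18.2 Lemma.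
* [MoonenZarhin1999LowDim] B. Moonen, Yu. Zarhin, *Hodge classes on abelian varieties of low dimension*, Math. Ann. 315
  (1999), Thm. (0.2) (a)/(4), Cor. (3.9).
* [Gordon1999HodgeAVSurvey] B. B. Gordon, *A survey of the Hodge conjecture for abelian varieties*, §3 Theorem (proof).
-/

noncomputable section

open NumberField NumberField.ComplexEmbedding
open scoped BigOperators

namespace Summit.HodgeConjecture.CorCM.SignCharacter

open Literature.NumberTheory.ComplexMultiplication
open Literature.AlgebraicGeometry.Pohlmann1968

/-! ## §1 Sign characters: values `±1`, odd at complex conjugation -/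

section Values

variable {K : Type} [Field K] [NumberField K]

omit [NumberField K] in
/-- Pointwise form of the eigen-relation `f ∘ g = χ(g) f`. [folklore] -/
theorem apply_smul_of_eigen {χ : (ℂ ≃+* ℂ) → ℚ} {f : (K →+* ℂ) → ℚ}
    (hf : ∀ g : ℂ ≃+* ℂ, (fun x => f (g • x)) = χ g • f) (g : ℂ ≃+* ℂ) (x : K →+* ℂ) :
    f (g • x) = χ g * f x := by
  have := congrFun (hf g) x
  simpa only [Pi.smul_apply, smul_eq_mul] using this

/-- **A character with a non-zero eigenvector on `ℚ^{Hom(K, ℂ)}` takes the values `±1`**: `g` permutes `Hom(K, ℂ)`, so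
`Σ_s f(g ∘ s)² = Σ_s f(s)² = χ(g)² Σ_s f(s)²` with `Σ_s f(s)² > 0`. [folklore] -/
theorem eq_one_or_eq_neg_one_of_eigen {χ : (ℂ ≃+* ℂ) → ℚ} {f : (K →+* ℂ) → ℚ}
    (hf : ∀ g : ℂ ≃+* ℂ, (fun x => f (g • x)) = χ g • f) (hf0 : f ≠ 0) (g : ℂ ≃+* ℂ) :
    χ g = 1 ∨ χ g = -1 := by
  classical
  obtain ⟨x₀, hx₀⟩ : ∃ x₀, f x₀ ≠ 0 := by
    by_contra hall
    push Not at hall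
    exact hf0 (funext hall)
  have hpos : 0 < ∑ x, f x * f x :=
    Finset.sum_pos' (fun x _ => mul_self_nonneg (f x)) ⟨x₀, Finset.mem_univ _, mul_self_pos.2 hx₀⟩
  have h1 : ∑ x, f (g • x) * f (g • x) = ∑ x, f x * f x :=
    Fintype.sum_equiv (MulAction.toPerm g) _ _ fun x => rfl
  have h2 : ∑ x, f (g • x) * f (g • x) = χ g * χ g * ∑ x, f x * f x := by
    rw [Finset.mul_sum]
    exact Finset.sum_congr rfl fun x _ => by rw [apply_smul_of_eigen hf]; ring
  rw [h1] at h2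
  have h3 : (χ g * χ g - 1) * ∑ x, f x * f x = 0 := by rw [sub_mul, one_mul, ← h2, sub_self]
  exact mul_self_eq_one_iff.1 (by linarith [(mul_eq_zero.1 h3).resolve_right hpos.ne'])

omit [NumberField K] in
/-- `χ(g⁻¹) χ(g) = 1` on a point where `f ≠ 0`. [folklore] -/
theorem apply_inv_mul_apply_of_eigen {χ : (ℂ ≃+* ℂ) → ℚ} {f : (K →+* ℂ) → ℚ}
    (hf : ∀ g : ℂ ≃+* ℂ, (fun x => f (g • x)) = χ g • f) {x₀ : K →+* ℂ} (hx₀ : f x₀ ≠ 0) (g : ℂ ≃+* ℂ) :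
    χ g⁻¹ * χ g = 1 := by
  have h1 : f x₀ = χ g⁻¹ * χ g * f x₀ := by
    conv_lhs => rw [← inv_smul_smul g x₀]
    rw [apply_smul_of_eigen hf, apply_smul_of_eigen hf, mul_assoc]
  have h2 : (χ g⁻¹ * χ g - 1) * f x₀ = 0 := by rw [sub_mul, one_mul, ← h1, sub_self]
  linarith [(mul_eq_zero.1 h2).resolve_right hx₀]

/-- **An eigenvector takes only the values `±f(x₀)`** (`Aut(ℂ)` acts transitively on `Hom(K, ℂ)`).
[cite: Gordon1999HodgeAVSurvey, §3 Theorem (proof)] -/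
theorem apply_eq_or_eq_neg_of_eigen {χ : (ℂ ≃+* ℂ) → ℚ} {f : (K →+* ℂ) → ℚ}
    (hf : ∀ g : ℂ ≃+* ℂ, (fun x => f (g • x)) = χ g • f) (hf0 : f ≠ 0) (x₀ x : K →+* ℂ) :
    f x = f x₀ ∨ f x = -f x₀ := by
  haveI := isPretransitive_ringEquiv_complex (K := K)
  obtain ⟨g, rfl⟩ := MulAction.exists_smul_eq (ℂ ≃+* ℂ) x₀ x
  rw [apply_smul_of_eigen hf]
  rcases eq_one_or_eq_neg_one_of_eigen hf hf0 g with h | h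
  · left; rw [h, one_mul]
  · right; rw [h, neg_one_mul]

/-- **A sign character is odd**: an ANTI-INVARIANT non-zero eigenvector forces `χ(conj) = −1`. [cite: Shimura1998, §18.2 Lemma] -/
theorem eq_neg_one_of_eigen {χ : (ℂ ≃+* ℂ) → ℚ} {f : (K →+* ℂ) → ℚ}
    (hf : ∀ g : ℂ ≃+* ℂ, (fun x => f (g • x)) = χ g • f)
    (hanti : ∀ x, f ((starRingAut : ℂ ≃+* ℂ) • x) = -f x) (hf0 : f ≠ 0) :
    χ (starRingAut : ℂ ≃+* ℂ) = -1 := by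
  obtain ⟨x₀, hx₀⟩ : ∃ x₀, f x₀ ≠ 0 := by
    by_contra hall
    push Not at hall
    exact hf0 (funext hall)
  have h1 := apply_smul_of_eigen hf (starRingAut : ℂ ≃+* ℂ) x₀
  rw [hanti] at h1
  have h2 : (χ starRingAut + 1) * f x₀ = 0 := by rw [add_mul, one_mul, ← h1, neg_add_cancel]
  linarith [(mul_eq_zero.1 h2).resolve_right hx₀]

end Values

/-! ## §2 The level set of an anti-invariant eigenvector is the fibre of an imaginary quadratic subfield -/

section Subfield

variable {K : Type} [Field K] [NumberField K]

/-- Every embedding of a subfield extends to `K` (`K/k` algebraic, `ℂ` algebraically closed). [folklore] -/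
private theorem exists_comp_eq_of_ringHom {k : Type} [Field k] (jk : k →+* K) (τ : k →+* ℂ) :
    ∃ φ : K →+* ℂ, φ.comp jk = τ := by
  letI : Algebra k K := jk.toAlgebra
  letI : Algebra k ℂ := τ.toAlgebra
  haveI : CharZero k := jk.charZero
  haveI : IsScalarTower ℚ k K := IsScalarTower.of_algebraMap_eq fun x => (map_ratCast jk x).symm
  haveI : Algebra.IsAlgebraic k K := Algebra.IsAlgebraic.tower_top (K := ℚ) k
  let ψ : K →ₐ[k] ℂ := IsAlgClosed.lift
  exact ⟨ψ.toRingHom, ψ.comp_algebraMap⟩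

omit [NumberField K] in
/-- Complex conjugation acts as an involution on `Hom(K, ℂ)`. [folklore] -/
private theorem conj_smul_conj_smul (x : K →+* ℂ) :
    (starRingAut : ℂ ≃+* ℂ) • (starRingAut : ℂ ≃+* ℂ) • x = x :=
  RingHom.ext fun y => by simp [ringEquiv_smul_apply]

/-- **The level set of an anti-invariant eigenvector is the fibre of an imaginary QUADRATIC subfield.**  For a sign
character `χ` carried by `K` with anti-invariant eigenvector `f ≠ 0` and `f(x₀) ≠ 0`: there is an intermediate field
`k ⊆ K` of degree `2`, TOTALLY COMPLEX, with `{s | f(s) = f(x₀)} = {s | s|_k = x₀|_k}`, and every automorphism of `ℂ`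
fixing the embeddings of `k` has `χ = 1`.  (The level set is a block with two translates — `χ(τ) = 1`: `τS = S`;
`χ(τ) = −1`: `τS = {f = −f(x₀)} = Hom(K, ℂ) ∖ S` —; Shimura's set-stabiliser argument gives `k`; `|S| = |S̄|` gives
`[K:k] = [K:ℚ]/2`; `x̄₀ ∉ S` excludes a real place of `k`.) [cite: Shimura1998, §8.2 (proof of Prop. 26) and §8.3 Prop. 28]
[cite: MoonenZarhin1999LowDim, Cor. (3.9)] -/
theorem exists_quadratic_subfield_of_eigen {χ : (ℂ ≃+* ℂ) → ℚ} {f : (K →+* ℂ) → ℚ}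
    (hf : ∀ g : ℂ ≃+* ℂ, (fun x => f (g • x)) = χ g • f)
    (hanti : ∀ x, f ((starRingAut : ℂ ≃+* ℂ) • x) = -f x) {x₀ : K →+* ℂ} (hx₀ : f x₀ ≠ 0) :
    ∃ k : IntermediateField ℚ K, Module.finrank ℚ k = 2 ∧ IsTotallyComplex k ∧
      (∀ s : K →+* ℂ, f s = f x₀ ↔ s.comp (algebraMap k K) = x₀.comp (algebraMap k K)) ∧
      ∀ τ : ℂ ≃+* ℂ, (∀ u : k →+* ℂ, τ • u = u) → χ τ = 1 := by
  classical
  have hf0 : f ≠ 0 := fun h0 => hx₀ (by rw [h0]; rfl)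
  haveI := isPretransitive_ringEquiv_complex (K := K)
  have hval := apply_eq_or_eq_neg_of_eigen hf hf0 x₀
  have hne : f x₀ ≠ -f x₀ := fun h => hx₀ (by linarith)
  -- the level set is a block with two translates
  set S : Set (K →+* ℂ) := {s | f s = f x₀} with hS
  have hmem : ∀ s, s ∈ S ↔ f s = f x₀ := fun s => Iff.rfl
  have hblock : ∀ τ : ℂ ≃+* ℂ, (∀ s : K →+* ℂ, τ • s ∈ S ↔ s ∈ S) ∨ (∀ s : K →+* ℂ, τ • s ∈ S ↔ s ∉ S) := by
    intro τ
    rcases eq_one_or_eq_neg_one_of_eigen hf hf0 τ with h1 | h1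
    · refine Or.inl fun s => ?_
      rw [hmem, hmem, apply_smul_of_eigen hf, h1, one_mul]
    · refine Or.inr fun s => ?_
      rw [hmem, hmem, apply_smul_of_eigen hf, h1, neg_one_mul]
      rcases hval s with h2 | h2
      · rw [h2]; exact ⟨fun h => absurd h.symm hne, fun h => absurd rfl h⟩
      · rw [h2, neg_neg]; exact ⟨fun _ h => hne h.symm, fun _ => rfl⟩
  obtain ⟨k, hk⟩ := exists_intermediateField_forall_mem_iff_of_block S (show x₀ ∈ S from rfl) hblock
  -- automorphisms fixing `k ⊂ ℂ` stabilise the fibre, hence have `χ = 1`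
  have hχk : ∀ τ : ℂ ≃+* ℂ, (∀ u : k →+* ℂ, τ • u = u) → χ τ = 1 := by
    intro τ hτ
    have h1 : τ • x₀ ∈ S := by
      rw [hk]
      exact hτ (x₀.comp (algebraMap k K))
    rw [hmem, apply_smul_of_eigen hf] at h1
    have h2 : (χ τ - 1) * f x₀ = 0 := by rw [sub_mul, one_mul, h1, sub_self]
    linarith [(mul_eq_zero.1 h2).resolve_right hx₀]
  -- `|S| = [K : k]` and `|S| = |Hom(K, ℂ) ∖ S|`, so `[k : ℚ] = 2`
  have hdeg : Module.finrank ℚ k = 2 := by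
    set A := Finset.univ.filter fun s : K →+* ℂ => f s = f x₀ with hA
    have hAfib : A = Finset.univ.filter fun s : K →+* ℂ =>
        s.comp (algebraMap k K) = x₀.comp (algebraMap k K) :=
      Finset.filter_congr fun s _ => (hmem s).symm.trans (hk s)
    have hAcard : A.card = Module.finrank k K := by rw [hAfib, card_fibre_eq_finrank]
    have hB : (Finset.univ.filter fun s : K →+* ℂ => ¬f s = f x₀) =
        A.image fun s => (starRingAut : ℂ ≃+* ℂ) • s := by
      ext y
      simp only [hA, Finset.mem_filter, Finset.mem_univ, true_and, Finset.mem_image]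
      constructor
      · intro hy
        refine ⟨(starRingAut : ℂ ≃+* ℂ) • y, ?_, conj_smul_conj_smul y⟩
        rw [hanti]
        rcases hval y with h2 | h2
        · exact absurd h2 hy
        · rw [h2, neg_neg]
      · rintro ⟨s, hs, rfl⟩
        rw [hanti, hs]
        exact fun h => hne h.symm
    have hsum := Finset.card_filter_add_card_filter_not (s := (Finset.univ : Finset (K →+* ℂ)))
      (fun s => f s = f x₀)
    rw [hB, Finset.card_image_of_injective _ (MulAction.injective (starRingAut : ℂ ≃+* ℂ)), Finset.card_univ,
      Embeddings.card, ← hA] at hsum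
    have hApos : 0 < A.card := Finset.card_pos.2 ⟨x₀, by simp [hA]⟩
    have hmul := Module.finrank_mul_finrank ℚ k K
    rw [← hAcard] at hmul
    nlinarith
  -- `k` is totally complex: a real place of `k` would put a conjugate of `x₀` in `S`
  have htc : IsTotallyComplex k := by
    refine ⟨fun v => InfinitePlace.not_isReal_iff_isComplex.mp fun hv => ?_⟩
    have hr : conjugate v.embedding = v.embedding :=
      ComplexEmbedding.isReal_iff.mp (InfinitePlace.isReal_iff.mp hv)
    obtain ⟨φ, hφ⟩ := exists_comp_eq_of_ringHom (algebraMap k K) v.embedding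
    obtain ⟨g, hg⟩ := MulAction.exists_smul_eq (ℂ ≃+* ℂ) x₀ φ
    -- `s = g⁻¹ ∘ conj ∘ g ∘ x₀` restricts to `x₀|_k`
    have hs : (g⁻¹ • (starRingAut : ℂ ≃+* ℂ) • g • x₀).comp (algebraMap k K) = x₀.comp (algebraMap k K) := by
      have h1 : ((starRingAut : ℂ ≃+* ℂ) • φ).comp (algebraMap k K) = φ.comp (algebraMap k K) := by
        rw [conj_smul_eq_conjugate, ← conjugate_comp_ringHom, hφ, hr]
      have h2 : ∀ (τ : ℂ ≃+* ℂ) (s : K →+* ℂ),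
          (τ • s).comp (algebraMap k K) = τ.toRingHom.comp (s.comp (algebraMap k K)) := fun _ _ => rfl
      rw [hg, h2, h1, ← h2, ← hg, inv_smul_smul]
    have h3 : f (g⁻¹ • (starRingAut : ℂ ≃+* ℂ) • g • x₀) = f x₀ := (hmem _).1 ((hk _).2 hs)
    rw [apply_smul_of_eigen hf, hanti, apply_smul_of_eigen hf] at h3
    have h4 := apply_inv_mul_apply_of_eigen hf hx₀ g
    have h5 : (χ g⁻¹ * χ g + 1) * f x₀ = 0 := by nlinarith [h3, h4]
    rw [h4] at h5
    exact hx₀ (by linarith [(mul_eq_zero.1 h5).resolve_left (by norm_num)])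
  exact ⟨k, hdeg, htc, fun s => (hmem s).symm.trans (hk s), hχk⟩

end Subfield

/-! ## §3 A sign character shared by two fields: the quadratic field embeds in the partner -/

section Shared

variable {K K' : Type} [Field K] [NumberField K] [Field K'] [NumberField K']

/-- **A shared sign character is the sign of a shared imaginary quadratic field.**  If one `χ : Aut(ℂ) → ℚ` has non-zero
ANTI-INVARIANT eigenvectors `f` on `ℚ^{Hom(K, ℂ)}` and `f'` on `ℚ^{Hom(K', ℂ)}`, then some imaginary quadratic subfield of
`K` embeds in `K'`.  (By §2, `χ = 1` on the automorphisms fixing the quadratic field `k ⊆ K` cut out by `f`; were `k`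
foreign to `K'`, these would act transitively on `Hom(K', ℂ)` — `exists_ringEquiv_smul_eq_of_isEmpty` —, making `f'`
constant, and an anti-invariant constant vanishes.)  This is the converse of the shared-character obstruction
(`CMTypeRankSharedCharacter`, `SharedImaginaryQuadraticDegenerate`): common sign-character constituents of two slots come
from, and only from, shared imaginary quadratic subfields. [cite: MoonenZarhin1999LowDim, Thm. (0.2) (a)/(4) and Cor. (3.9)]
[cite: Gordon1999HodgeAVSurvey, §3 Theorem (proof)] -/
theorem exists_quadratic_subfield_ringHom_of_shared_eigen (χ : (ℂ ≃+* ℂ) → ℚ) {f : (K →+* ℂ) → ℚ}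
    {f' : (K' →+* ℂ) → ℚ} (hf : ∀ g : ℂ ≃+* ℂ, (fun x => f (g • x)) = χ g • f)
    (hanti : ∀ x, f ((starRingAut : ℂ ≃+* ℂ) • x) = -f x) (hf0 : f ≠ 0)
    (hf' : ∀ g : ℂ ≃+* ℂ, (fun y => f' (g • y)) = χ g • f')
    (hanti' : ∀ y, f' ((starRingAut : ℂ ≃+* ℂ) • y) = -f' y) (hf'0 : f' ≠ 0) :
    ∃ F : IntermediateField ℚ K, Module.finrank ℚ F = 2 ∧ IsTotallyComplex F ∧ Nonempty (F →+* K') := by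
  obtain ⟨x₀, hx₀⟩ : ∃ x₀, f x₀ ≠ 0 := by
    by_contra hall
    push Not at hall
    exact hf0 (funext hall)
  obtain ⟨k, hk2, hkc, -, hχk⟩ := exists_quadratic_subfield_of_eigen hf hanti hx₀
  refine ⟨k, hk2, hkc, ?_⟩
  by_contra hne
  rw [not_nonempty_iff] at hne
  obtain ⟨y₀, hy₀⟩ : ∃ y₀, f' y₀ ≠ 0 := by
    by_contra hall
    push Not at hall
    exact hf'0 (funext hall)
  -- the stabiliser of `Hom(k, ℂ)` is transitive on `Hom(K', ℂ)` and has `χ = 1`: `f'` is constant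
  have hconst : ∀ y, f' y = f' y₀ := by
    intro y
    obtain ⟨τ, hτu, hτy⟩ := exists_ringEquiv_smul_eq_of_isEmpty hk2 hne y₀ y
    rw [← hτy, apply_smul_of_eigen hf', hχk τ hτu, one_mul]
  have h1 := hconst ((starRingAut : ℂ ≃+* ℂ) • y₀)
  rw [hanti'] at h1
  exact hy₀ (by linarith)

/-- Symmetric reading: the shared quadratic field also sits inside `K'` and embeds in `K`. [cite: MoonenZarhin1999LowDim, Cor. (3.9)] -/
theorem exists_quadratic_subfield_ringHom_of_shared_eigen' (χ : (ℂ ≃+* ℂ) → ℚ) {f : (K →+* ℂ) → ℚ}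
    {f' : (K' →+* ℂ) → ℚ} (hf : ∀ g : ℂ ≃+* ℂ, (fun x => f (g • x)) = χ g • f)
    (hanti : ∀ x, f ((starRingAut : ℂ ≃+* ℂ) • x) = -f x) (hf0 : f ≠ 0)
    (hf' : ∀ g : ℂ ≃+* ℂ, (fun y => f' (g • y)) = χ g • f')
    (hanti' : ∀ y, f' ((starRingAut : ℂ ≃+* ℂ) • y) = -f' y) (hf'0 : f' ≠ 0) :
    ∃ F : IntermediateField ℚ K', Module.finrank ℚ F = 2 ∧ IsTotallyComplex F ∧ Nonempty (F →+* K) :=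
  exists_quadratic_subfield_ringHom_of_shared_eigen χ hf' hanti' hf'0 hf hanti hf0

end Shared

end Summit.HodgeConjecture.CorCM.SignCharacter

end
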